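import Summits.CriticalPhenomena.CardyFormulaZ2.Theorems.CardyIKTransportIKMixedBoxCrossingDefectStubEvenLaw

/-!
# The free IK colour law as a mixture of pivot-completed uniform fillings (lead c3, programme (R), L1)

Crux `IKMixedBoxCrossing` (stmt-CriticalPhenomena-5911), line `defect-closure-exploration`.  Combining the landed
mask mixture (`stub_gadget`, `GadgetRepresentation`) with the landed pivot-completion form of the `t = 0` members
(`stub_evenLawApply`): for every column pattern `S`, finite volume `Λ` and measurable event `E` of colourings,
`colourLaw S Λ E = ∑_{D ⊆ V} ρ^|D| (1−ρ)^{|V|−|D|} · 2^{−|Λ|} · #{s ⊆ Λ : the D-even completion of the filling s lies in E}`,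
`V = facesIn S Λ`, `ρ = maskDensity tIK = 7 − 4√3`.  This is the exact PRODUCT representation of the IK colour field
(i.i.d. fair filling bits on `Λ` ⊗ i.i.d. Bernoulli(ρ) defect bits on `V`, read through the deterministic pivot
completion), on which Reimer's inequality (`stub_reimerHarrisDeficit`) acts.
-/

namespace Summit.CriticalPhenomena.CardyFormulaZ2.Cruxes.IKMixedBoxCrossing.DefectClosureExploration

open scoped ENNReal NNReal Classical
open MeasureTheory Finset
open Literature.Probability.LatticeModels

/-- Faces of the pattern inside `Λ` are inner faces of `Λ`. -/
theorem facesIn_subset_innerVertices (S : Set ℤ) (Λ : Finset (Site 2)) : facesIn S Λ ⊆ innerVertices Λ :=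
  Finset.filter_subset _ _

/-- **Registered stub `stub_colourLawMixture`** (THE PRODUCT REPRESENTATION OF THE FREE IK COLOUR LAW): for every
pattern `S`, finite volume `Λ` and measurable `E`,
`colourLaw S Λ E = ∑_{D ∈ (facesIn S Λ).powerset} ofReal(ρ^|D| (1−ρ)^{|V|−|D|}) · (2^|Λ|)⁻¹ ·
  #{s ∈ Λ.powerset | ∃ σ ∈ E, σ = boxFill Λ white s off D.image (·+1) ∧ σ is D-even}`
with `ρ = maskDensity tIK`, `V = facesIn S Λ` — `stub_gadget` (mask mixture at `t = tIK ≤ 1`) followed by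
`stub_evenLawApply` (each `t = 0` member is the pivot-completed uniform filling law). -/
theorem stub_colourLawMixture : ∀ (S : Set ℤ) (Λ : Finset (Site 2)) (E : Set (Site 2 → Bool)), MeasurableSet E →
    colourLaw S Λ E =
      ∑ D ∈ (facesIn S Λ).powerset,
        ENNReal.ofReal (maskDensity tIK ^ D.card * (1 - maskDensity tIK) ^ ((facesIn S Λ).card - D.card)) *
          (((2 : ENNReal) ^ Λ.card)⁻¹ *
            ((Λ.powerset.filter fun s => ∃ σ ∈ E,
                (∀ x : Site 2, x ∉ D.image (· + 1) → σ x = boxFill Λ (fun _ => false) s x) ∧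
                  ∀ g ∈ D, ¬ IsOddFace σ g).card : ENNReal)) := by
  intro S Λ E hE
  have htIK : tIK ≤ 1 := by
    rw [← NNReal.coe_le_coe, coe_tIK, NNReal.coe_one]
    have h3 : Real.sqrt 3 < 2 := by
      rw [show (2 : ℝ) = Real.sqrt 4 by rw [show (4 : ℝ) = 2 ^ 2 by norm_num, Real.sqrt_sq (by norm_num)]]
      exact Real.sqrt_lt_sqrt (by norm_num) (by norm_num)
    linarith
  have hV := facesIn_subset_innerVertices S Λ
  rw [colourLaw, stub_gadget tIK htIK (facesIn S Λ) Λ hV (fun _ => false), Measure.finsetSum_apply]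
  refine Finset.sum_congr rfl fun D hD => ?_
  rw [Measure.smul_apply, smul_eq_mul,
    stub_evenLawApply D Λ ((Finset.mem_powerset.1 hD).trans hV) (fun _ => false) E hE]

end Summit.CriticalPhenomena.CardyFormulaZ2.Cruxes.IKMixedBoxCrossing.DefectClosureExploration
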